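import Summits.BirchSwinnertonDyer.BirchSwinnertonDyer.Theorems.ThetaPartnerAtTwoSignedKatoUpToAtTwoFlatDualRestriction
import Summits.BirchSwinnertonDyer.BirchSwinnertonDyer.Theorems.ThetaPartnerAtTwoSignedKatoUpToAtTwoOffTwo
import Literature.NumberTheory.EllipticCurves.CyclotomicZpExtensionLocalGeneratorProofs
import HarnessLib

/-!
# Route `ThetaPartnerAtTwo` (TP2), crux K3 `SignedKatoDivisibilityUpToAtTwo` (item stmt-BirchSwinnertonDyer-20308),
# line `colemanrat` v3 — file 19: **THE ♭ ROAD TO K3** — `SignedKatoDivisibilityUpToAtTwo` BY NAME from TWO displayed hypotheses: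
# (H) HONDA⁺@2 (the body of K4's stub `stub_plusHondaSystemTwo`, crux `SignedControlAtTwo`) and
# (F) «♭-KATO DIVISIBILITY OFF `2`»: `ℓ_𝔭(X♭(E/ℚ_∞)) ≤ ℓ_𝔭(Λ/(L♭))` at every height-one `𝔭 ∌ 2` for Sprung's ♭ dual data at `a₂ = 0`
# — the research statement in the currency of the `bsd-2adic` cell's Col♭ machinery (crux 19097 `SupersingularRankZeroAtTwo`)

HONEST FRAMING (cell `bsd-wall`, width seat `bsd-wall-tp2-p2x-w2` g2): THEOREMS ONLY — no definition, no named fact, no instance,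
no `sorry`; the K3-level theorem is CONDITIONAL on the two displayed hypotheses (H) and (F) — (F) is NOT in print at `p = 2` (Sprung
2012 Thm. 7.14/7.16 are for odd `p`; Kurihara–Otsuki 2006 p. 557 assert the `a₂ = 0` case) and is exactly as hard as the crux; closes
no item (`proof.conditional`); BSD is NOT proved by any of this.

## Why this file (a re-lining certificate for the route pen)

The line `colemanrat` closes K3 from the 2-adic Coleman/Poitou–Tate package (C2), whose map `col : 𝐇¹ → P` needs a local Tate
pairing the tree does not have at any `p`. Files 16–18 of this seat show that at `a₂ = 0` KOBAYASHI's `Sel⁺` (K3's object) sits inside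
SPRUNG's `Sel♭` (the object of the `bsd-2adic` cell's road, where the ♭ Coleman map, its kernel, biduality and `(E♭_∞)_Γ = 0` are
kernel theorems under explicit Honda clauses), with `X♭ ↠ X⁺` and `ℓ_𝔭(X⁺) ≤ ℓ_𝔭(X♭)` on the PINNED data. Hence K3's certified local
form off `2` («`X⁺` torsion ⇒ `ℓ_𝔭(X⁺) ≤ ℓ_𝔭(Λ/(L♭))` at height-one `𝔭 ∌ 2`», `SignedKatoOffTwo.signedKatoDivisibilityUpToAtTwo_of_offTwo`,
p566943) follows from the SAME inequality for `X♭` — ONE `p = 2` research statement (F) serving both TP2/RTT's K3 and 19097 —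
plus HONDA⁺@2 (H), which K4's seats are constructing (`…LocalTwoPlusPoints*`, `…PlusHondaTransport*`). The local lift `g` of the
topological generator exists (`ZpExtension.IsCyclotomic.exists_isTopGenerator_resGalOfEmb_adicCompletion`), the place `v ∋ 2` exists,
and ♭ dual data exist (`Sprung2012.nonempty_sharpFlatSelmerDualData'`), so nothing else is assumed.

## What is proved

* `exists_heightOneSpectrum_two_mem` — a place of `ℚ` above `2` exists.
* **`signedKatoDivisibilityUpToAtTwo_of_flatOffTwo_of_honda`** — K3 BY NAME from (H) and (F).

References: [Kobayashi2003] S. Kobayashi, Invent. Math. 152 (2003), Thm. 1.3 (i), Def. 1.1, (7.21), Thm. 8.18–Prop. 8.23; [Sprung2012]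
F. Sprung, J. Number Theory 132 (2012), Def. 7.9–7.11, Thm. 7.14, 7.16; [KuriharaOtsuki2006] p. 557; [Kato2004Asterisque] Thm. 17.4.
-/

set_option autoImplicit false
-- the Theorems namespace of this sub repeats the summit name by design (D-0017 nested layout)
set_option linter.dupNamespace false

noncomputable section

open scoped Classical MatrixGroups ModularForm NumberField

universe u

namespace Summit.BirchSwinnertonDyer.BirchSwinnertonDyer.Theorems

namespace SignedKatoOffTwo.FlatKernel

open CongruenceSubgroup NumberField IsDedekindDomain WeierstrassCurve Field
  Literature.NumberTheory.GaloisRepresentations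
  Literature.NumberTheory.EllipticCurves Literature.NumberTheory.EllipticCurves.ModularForms
  Literature.NumberTheory.EllipticCurves.Module Literature.NumberTheory.EllipticCurves.Rank1Residual
  Literature.NumberTheory.EllipticCurves.Kobayashi2003 Literature.NumberTheory.EllipticCurves.Sprung2012
  Literature.NumberTheory.EllipticCurves.Sprung2017 ZpExtension
  Summit.BirchSwinnertonDyer.Rank1Residual.Supersingular
  Summit.BirchSwinnertonDyer.BirchSwinnertonDyer.Theses.ThetaPartnerAtTwo

/-- A finite place of `ℚ` above `2` exists (`(2)` is a non-zero prime of `ℤ`). [folklore] -/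
theorem exists_heightOneSpectrum_two_mem : ∃ v : HeightOneSpectrum (𝓞 ℚ), (2 : 𝓞 ℚ) ∈ v.asIdeal := by
  have hnu : ¬ IsUnit ((2 : ℕ) : 𝓞 ℚ) := by
    intro h
    have h' := h.map Rat.ringOfIntegersEquiv
    rw [map_natCast, Int.isUnit_iff_natAbs_eq, Int.natAbs_natCast] at h'
    exact absurd h' (by norm_num)
  obtain ⟨M, hM, hle⟩ := Ideal.exists_le_maximal (Ideal.span {((2 : ℕ) : 𝓞 ℚ)})
    (by rwa [Ne, Ideal.span_singleton_eq_top])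
  have h2M : ((2 : ℕ) : 𝓞 ℚ) ∈ M := hle (Ideal.mem_span_singleton_self _)
  refine ⟨⟨M, hM.isPrime, fun hbot => ?_⟩, by exact_mod_cast h2M⟩
  rw [hbot, Ideal.mem_bot] at h2M
  exact absurd (by exact_mod_cast h2M : (2 : ℕ) = 0) (by norm_num)

/-- **THE ♭ ROAD: K3 `SignedKatoDivisibilityUpToAtTwo` BY NAME from HONDA⁺@2 and the ♭-Kato divisibility off `2`.**
Hypotheses: (H) for every curve of the theta habitat, the cyclotomic `κ` and the place `v ∋ 2`, a plus Honda system at `2` over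
`ℚ_v` with the chosen embedding — clauses (L) (TR) (GEN) (GEN₀), VERBATIM the body of K4's `stub_plusHondaSystemTwo`; (F) for every
habitat datum, every such Honda system `d`, every local lift `g` of `γ` and EVERY pinned ♭ dual datum
`D♭ : SharpFlatSelmerDualData W κ γ (closureEmb ℚ_v) 0 g d .flat`: `ℓ_𝔭(D♭.X) ≤ ℓ_𝔭(Λ/(kobayashiL 1 L⁺ L⁻))` at every height-one
`𝔭 ∌ 2` («♭-Kato divisibility off `2`», the `a₂ = 0` case of Sprung's Thm. 7.16 at `p = 2`; NOT in print). Proof: K3's local form off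
`2` (`signedKatoDivisibilityUpToAtTwo_of_offTwo`) for a pinned `D` follows from `ℓ_𝔭(D.X) ≤ ℓ_𝔭(D♭.X)` (file 18, from `Sel⁺ ≤ Sel♭`,
files 16–17) and (F). [cite: Kobayashi2003, Thm. 1.3 (i) (p. 2), Thm. 8.18–Prop. 8.23] [cite: Sprung2012, Def. 7.11, Thm. 7.14 and Thm. 7.16 (pp. 1503–1505)]
[cite: KuriharaOtsuki2006, p. 557] -/
theorem signedKatoDivisibilityUpToAtTwo_of_flatOffTwo_of_honda
    (hH : ∀ (W : WeierstrassCurve ℚ) [W.IsElliptic] [W.IsGloballyMinimal],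
      ¬ W.HasCM → W.analyticRank = 0 → GoodSS W 2 → W.frobeniusTrace 2 = 0 →
      ∀ (κ : ZpExtension ℚ 2), κ.IsCyclotomic →
      ∀ (v : HeightOneSpectrum (𝓞 ℚ)), (2 : 𝓞 ℚ) ∈ v.asIdeal →
      ∃ d : ℕ → localPoints W (v.adicCompletion ℚ),
        (∀ m, d m ∈ localLayerPointsOfEmb κ (closureEmb (K := ℚ) (v.adicCompletion ℚ)) W m) ∧
        (∀ m, localTraceOfEmb κ (closureEmb (K := ℚ) (v.adicCompletion ℚ)) W (m + 1) (m + 2) (d (m + 2)) = -d m) ∧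
        (∀ m : ℕ, 1 ≤ m → ∀ P ∈ localLayerPointsOfEmb κ (closureEmb (K := ℚ) (v.adicCompletion ℚ)) W m,
          ∃ B ∈ AddSubgroup.closure (Set.range fun σ : Field.absoluteGaloisGroup (v.adicCompletion ℚ) ↦ σ • d m),
            ∃ P' ∈ localLayerPointsOfEmb κ (closureEmb (K := ℚ) (v.adicCompletion ℚ)) W (m - 1),
            ∃ R ∈ localLayerPointsOfEmb κ (closureEmb (K := ℚ) (v.adicCompletion ℚ)) W m, P = B + P' + 2 • R) ∧
        (∀ P ∈ localLayerPointsOfEmb κ (closureEmb (K := ℚ) (v.adicCompletion ℚ)) W 0,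
          ∃ a : ℤ, ∃ R ∈ localLayerPointsOfEmb κ (closureEmb (K := ℚ) (v.adicCompletion ℚ)) W 0, P = a • d 0 + 2 • R))
    (hF : ∀ (W : WeierstrassCurve ℚ) [W.IsElliptic] [W.IsGloballyMinimal],
      ¬ W.HasCM → W.analyticRank = 0 → GoodSS W 2 → W.frobeniusTrace 2 = 0 →
      ∀ (κ : ZpExtension ℚ 2) (γ : Field.absoluteGaloisGroup ℚ),
        κ.IsCyclotomic → κ.IsTopGenerator γ → IsCyclotomicVariable 2 γ →
        ∀ [NeZero (W.conductorNorm ℤ)] (f : CuspForm (Gamma0 (W.conductorNorm ℤ)) 2),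
          IsNewformOf W f → ∀ (ϖ : ℚ), (ϖ : ℝ) * W.realPeriodRat = plusPeriod f →
        ∀ (Lplus Lminus : IwasawaAlgebra 2), IsPollackPair f 2 Lplus Lminus →
        ∀ (v : HeightOneSpectrum (𝓞 ℚ)), (2 : 𝓞 ℚ) ∈ v.asIdeal →
        ∀ (g : Field.absoluteGaloisGroup (v.adicCompletion ℚ)),
          κ.IsTopGenerator (resGalOfEmb (closureEmb (K := ℚ) (v.adicCompletion ℚ)) g) →
        ∀ (d : ℕ → localPoints W (v.adicCompletion ℚ)),
          (∀ m, d m ∈ localLayerPointsOfEmb κ (closureEmb (K := ℚ) (v.adicCompletion ℚ)) W m) →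
          (∀ m, localTraceOfEmb κ (closureEmb (K := ℚ) (v.adicCompletion ℚ)) W (m + 1) (m + 2) (d (m + 2)) = -d m) →
        ∀ (Df : SharpFlatSelmerDualData W κ γ (closureEmb (K := ℚ) (v.adicCompletion ℚ)) 0 g d .flat)
          (𝔭 : PrimeSpectrum (IwasawaAlgebra 2)), 𝔭.asIdeal.height = 1 → PowerSeries.C (2 : ℤ_[2]) ∉ 𝔭.asIdeal →
          lengthAt (IwasawaAlgebra 2) Df.X 𝔭 ≤
            lengthAt (IwasawaAlgebra 2) (IwasawaAlgebra 2 ⧸ Ideal.span {kobayashiL 1 Lplus Lminus}) 𝔭) :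
    SignedKatoDivisibilityUpToAtTwo := by
  refine signedKatoDivisibilityUpToAtTwo_of_offTwo ?_
  intro W _ _ hcm hr hss ha κ γ hκ hγ hcv _ f hf ϖ hϖ Lplus Lminus hPP D _ 𝔭 h𝔭 h2
  -- the place above `2`, a local lift of `γ`, a Honda system, a ♭ dual datum
  obtain ⟨v, hv⟩ := exists_heightOneSpectrum_two_mem
  obtain ⟨g, hg⟩ := hκ.exists_isTopGenerator_resGalOfEmb_adicCompletion v (by exact_mod_cast hv)
  obtain ⟨d, hd, htr, hgen, hgen0⟩ := hH W hcm hr hss ha κ hκ v hv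
  obtain ⟨Df⟩ := nonempty_sharpFlatSelmerDualData' W κ (closureEmb (K := ℚ) (v.adicCompletion ℚ)) (0 : ℤ) g d
    Chroma.flat γ
  -- `ℓ_𝔭(X⁺) ≤ ℓ_𝔭(X♭) ≤ ℓ_𝔭(Λ/(L♭))`
  exact (lengthAt_signed_le_lengthAt_sharpFlat_two W hss hκ v hv hg hd htr hgen hgen0 D Df 𝔭).trans
    (hF W hcm hr hss ha κ γ hκ hγ hcv f hf ϖ hϖ Lplus Lminus hPP v hv g hg d hd htr Df 𝔭 h𝔭 h2)

end SignedKatoOffTwo.FlatKernel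

end Summit.BirchSwinnertonDyer.BirchSwinnertonDyer.Theorems

end
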